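import Summits.QuantumFields.BalabanUV.Beta.D1BFx.PackedCoframeSepJets

/-!
# BetaPertH road «BF-x» — «COFRAME-MASS» M1b: the site kernels and the thirteen word shapes, ONE constant for all centres and weights

STATUS: [folklore] `ℓ¹` bookkeeping for the road's (A1)-PACKED identity (BINDER row D1, slot (K)); NOT an estimate of Bałaban's, NOT a discharge of any
root-level binder.  Provenance: reconstruction; the manuscript(s) under audit are NOT citable.

WHAT.  For weights of envelope `|w κ u| ≤ C·e^{−δ|u−P|₁}` (`|w′ κ u| ≤ C′·e^{−δ|u−P′|₁}`) and the DISPLAYED kernel letter `hG : Decays (Cgh n a) CG δ`,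
`0 < δ ≤ 1` (the consumer weakens the tree's `deltaCgh n a`∕`dB n a` — whose `∃ C` hide the constant — to a common `δ`; `decays_lapU` = `(16e, 1)`):
* §1 [folklore] SINGLE-WEIGHT kernels at `(P,P)` — `lapU∘Cgh∘gW w` (δ∕4), `gW w∘Cgh∘lapU` (δ∕4), `gW w∘Cgh` (δ∕4), `lapU∘Cgh∘qW w` (δ∕8), `(lapU∘Cgh∘qW w)∘Cgh`,
  `(lapU∘Cgh∘qW w)∘(Cgh∘lapU)` (δ∕16) — each as `∃ K, ∀ P w, (envelope) → BiLoc … P P K (rate)`: ONE constant for all centres and weights;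
* §2 [folklore] TWO-WEIGHT kernels at `(P,P′)` WITH SEPARATION — `d2W w w′` (product weight), `gW w∘Cgh∘gW w′`, `(lapU∘Cgh∘qW w)∘Cgh∘gW w′`,
  `(lapU∘Cgh∘qW w)∘Cgh∘qW w′∘(Cgh∘lapU)`, the `l2WInf` pieces and the `lapU∘Cgh ∘ T ∘ Cgh∘lapU` sandwich — `∃ K, ∀ P P′ w w′, … → BiLoc … (K·e^{−s|P−P′|₁}) ρ`;
* §3 [folklore] the thirteen WORD SHAPES of P4b's `k9Inf k5Inf k7Inf k4Inf` (letter `hR : Decays (Rgt n a) CR δ` for the `Rgt` words): W1 `dSw (LC∘d2W w w′)`,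
  W2 `jetCw w′ (LC∘gW w)`, W4 `jetCw (w·w′) Rgt`, W5 `dSw (gW w∘Cgh∘gW w′)`, W6 `jetCw w′ (gW w∘CL)`, W7 `jetRw w (LC∘gW w′)`, W8 `jetRCw w w′ Rgt`,
  W9 `dSw ((LC∘qW w∘Cgh)∘gW w′)`, W10 `jetCw w′ (LC∘qW w∘CL)`, W11a∕b∕d `dSw (LC∘T∘CL)`, W12 `dSw (((LC∘qW w∘Cgh)∘qW w′)∘CL)` (`LC := lapU∘Cgh`,
  `CL := Cgh∘lapU`; swapped instances `w ↔ w′` are the same lemmas).  M2 (`PackedCoframePairMass`) sums the masses.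
Unit `b2b-balaban-beta-d1-formalise-leaf-03` (gen 24); road owner `b2b-balaban-beta-d1-p2`.
-/

noncomputable section

namespace Summit.QuantumFields.BalabanUV.Beta.D1BFx.PackedCoframeSepKernels

open scoped BigOperators
open Literature.MathematicalPhysics.QuantumFieldTheory.Balaban1983to89
open Literature.MathematicalPhysics.QuantumFieldTheory.Balaban1983to89.Beta
open B12Sec2to5 (l1 l1_nonneg)
open ExpKernelCalculus (Site MKer BiLoc Decays comp Zl Zl_pos Zl_nonneg biLoc_comp_decays biLoc_comp_biLoc)
open BalabanStepJetsSucc (biLoc_comp_right)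
open OneStepResolventKernel (wsum)
open KernelWard (biLoc_recentre biLoc_add)
open StepJetData (biLoc_weaken)
open Summit.QuantumFields.BalabanUV.Beta.TameKernelCalculus (decays_of_le biLoc_of_le trK biLoc_trK)
open Summit.QuantumFields.BalabanUV.Beta.D1BFx.KGhostLeg (Cgh)
open Summit.QuantumFields.BalabanUV.Beta.D1BFx.GhostStencil (ghCur biLoc_ghCur l1_zero)
open Summit.QuantumFields.BalabanUV.Beta.D1BFx.TorusGhostPairStencils (gh₂ biLoc_gh₂)
open Summit.QuantumFields.BalabanUV.Beta.D1BFx.TorusGhostWordArrays (lapU decays_lapU)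
open Summit.QuantumFields.BalabanUV.Beta.D1BFx.PeriodicArrayPackingPlain (biLoc_dirsum_wsum)
open Summit.QuantumFields.BalabanUV.Beta.D1BFx.PackedCoframeSiteWords (gW qW d2W biLoc_gW biLoc_qW)
open Summit.QuantumFields.BalabanUV.Beta.D1BFx.PeriodicArrayWrapLimit (const_nonneg_of_weight)
open Summit.QuantumFields.BalabanUV.Beta.D1BFx.PackedCoframePairLimit (l2WInf)
open Summit.QuantumFields.BalabanUV.Beta.D1BFx.PackedCoframeSep (exp_sep_le abs_mul_weight_sep biLoc_recentre_snd biLoc_recentre_fst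
  biLoc_comp_decays_sep biLoc_comp_right_sep biLoc_comp_biLoc_sep)
open Summit.QuantumFields.BalabanUV.Beta.D1BFx.RJetProjector (Rgt)
open Summit.QuantumFields.BalabanUV.Beta.D1BFx.RJetAssembly (dSw)
open Summit.QuantumFields.BalabanUV.Beta.D1BFx.PackedPinnedLetters (jetRw jetCw jetRCw)
open Summit.QuantumFields.BalabanUV.Beta.D1BFx.PackedPinnedLettersLoc (biLoc_jetCw_of_decays)
open Summit.QuantumFields.BalabanUV.Beta.D1BFx.PackedCoframeSepJets (biLoc_dSw₂ biLoc_jetCw_of_biLoc biLoc_jetRw_of_biLoc biLoc_jetRCw_sep)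

/-! ## §1 The single-weight site kernels: constants UNIFORM in the centre and the weight -/

section SingleWeight

variable {n : ℕ} [NeZero n] {a : ℝ} {CG δ : ℝ}

/-- [folklore] The ghost Laplacian at any rate `δ ≤ 1` (from `decays_lapU` = `(16e, 1)`). -/
theorem decays_lapU_of_le_one (hδ1 : δ ≤ 1) : Decays lapU (|16 * Real.exp 1|) δ := decays_of_le decays_lapU hδ1

/-- [folklore] `lapU ∘ Cgh` decays at rate `δ∕2` with an explicit constant in the displayed letter `hG : Decays (Cgh n a) CG δ`. -/
theorem decays_LC (hG : Decays (Cgh n a) CG δ) (hδ : 0 < δ) (hδ1 : δ ≤ 1) :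
    Decays (comp lapU (Cgh n a)) ((Fintype.card Unit : ℝ) * (|16 * Real.exp 1| * CG) * Zl 4 (δ - δ / 2)) (δ / 2) :=
  BalabanStepJetsSucc.decays_comp (decays_lapU_of_le_one hδ1) hG (by linarith) (by linarith)

/-- [folklore] `Cgh ∘ lapU` likewise. -/
theorem decays_CL (hG : Decays (Cgh n a) CG δ) (hδ : 0 < δ) (hδ1 : δ ≤ 1) :
    Decays (comp (Cgh n a) lapU) ((Fintype.card Unit : ℝ) * (CG * |16 * Real.exp 1|) * Zl 4 (δ - δ / 2)) (δ / 2) :=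
  BalabanStepJetsSucc.decays_comp hG (decays_lapU_of_le_one hδ1) (by linarith) (by linarith)

/-- [folklore] **`lapU∘Cgh∘gW w` AT `(P,P)`, RATE `δ∕4`, ONE CONSTANT FOR ALL CENTRES AND WEIGHTS of envelope `(C, δ)`.** -/
theorem exists_biLoc_LC_gW (hG : Decays (Cgh n a) CG δ) (hδ : 0 < δ) (hδ1 : δ ≤ 1) (C : ℝ) :
    ∃ K : ℝ, ∀ (P : Site 4) (w : Fin 4 → (Fin 4 → ℤ) → ℝ), (∀ κ u, |w κ u| ≤ C * Real.exp (-δ * l1 (u - P))) →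
      BiLoc (comp (comp lapU (Cgh n a)) (gW w)) P P K (δ / 4) :=
  ⟨_, fun P w hw => biLoc_comp_decays (decays_of_le (decays_LC hG hδ hδ1) (le_refl _)) (biLoc_gW hw hδ)
    (by linarith) (by linarith)⟩

/-- [folklore] **`gW w∘Cgh∘lapU` AT `(P,P)`, RATE `δ∕4`.** -/
theorem exists_biLoc_gW_CL (hG : Decays (Cgh n a) CG δ) (hδ : 0 < δ) (hδ1 : δ ≤ 1) (C : ℝ) :
    ∃ K : ℝ, ∀ (P : Site 4) (w : Fin 4 → (Fin 4 → ℤ) → ℝ), (∀ κ u, |w κ u| ≤ C * Real.exp (-δ * l1 (u - P))) →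
      BiLoc (comp (gW w) (comp (Cgh n a) lapU)) P P K (δ / 4) :=
  ⟨_, fun P w hw => biLoc_comp_right (biLoc_gW hw hδ) (decays_of_le (decays_CL hG hδ hδ1) (le_refl _))
    (by linarith) (by linarith)⟩

/-- [folklore] **`gW w∘Cgh` AT `(P,P)`, RATE `δ∕4`.** -/
theorem exists_biLoc_gW_C (hG : Decays (Cgh n a) CG δ) (hδ : 0 < δ) (C : ℝ) :
    ∃ K : ℝ, ∀ (P : Site 4) (w : Fin 4 → (Fin 4 → ℤ) → ℝ), (∀ κ u, |w κ u| ≤ C * Real.exp (-δ * l1 (u - P))) →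
      BiLoc (comp (gW w) (Cgh n a)) P P K (δ / 4) :=
  ⟨_, fun P w hw => biLoc_comp_right (biLoc_gW hw hδ) (decays_of_le hG (by linarith)) (by linarith) (by linarith)⟩

/-- [folklore] **`lapU∘Cgh∘qW w` AT `(P,P)`, RATE `δ∕8`.** -/
theorem exists_biLoc_LC_qW (hG : Decays (Cgh n a) CG δ) (hδ : 0 < δ) (hδ1 : δ ≤ 1) (C : ℝ) :
    ∃ K : ℝ, ∀ (P : Site 4) (w : Fin 4 → (Fin 4 → ℤ) → ℝ), (∀ κ u, |w κ u| ≤ C * Real.exp (-δ * l1 (u - P))) →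
      BiLoc (comp (comp lapU (Cgh n a)) (qW w)) P P K (δ / 8) :=
  ⟨_, fun P w hw => biLoc_comp_decays (decays_of_le (decays_LC hG hδ hδ1) (by linarith))
    (PackedCoframeSiteWords.biLoc_qW hw hδ hδ1) (by linarith) (by linarith)⟩

/-- [folklore] **`(lapU∘Cgh∘qW w)∘Cgh` AT `(P,P)`, RATE `δ∕16`.** -/
theorem exists_biLoc_LC_qW_C (hG : Decays (Cgh n a) CG δ) (hδ : 0 < δ) (hδ1 : δ ≤ 1) (C : ℝ) :
    ∃ K : ℝ, ∀ (P : Site 4) (w : Fin 4 → (Fin 4 → ℤ) → ℝ), (∀ κ u, |w κ u| ≤ C * Real.exp (-δ * l1 (u - P))) →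
      BiLoc (comp (comp (comp lapU (Cgh n a)) (qW w)) (Cgh n a)) P P K (δ / 16) := by
  obtain ⟨K, hK⟩ := exists_biLoc_LC_qW hG hδ hδ1 C
  exact ⟨_, fun P w hw => biLoc_comp_right (hK P w hw) (decays_of_le hG (by linarith)) (by linarith) (by linarith)⟩

/-- [folklore] **`(lapU∘Cgh∘qW w)∘(Cgh∘lapU)` AT `(P,P)`, RATE `δ∕16`.** -/
theorem exists_biLoc_LC_qW_CL (hG : Decays (Cgh n a) CG δ) (hδ : 0 < δ) (hδ1 : δ ≤ 1) (C : ℝ) :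
    ∃ K : ℝ, ∀ (P : Site 4) (w : Fin 4 → (Fin 4 → ℤ) → ℝ), (∀ κ u, |w κ u| ≤ C * Real.exp (-δ * l1 (u - P))) →
      BiLoc (comp (comp (comp lapU (Cgh n a)) (qW w)) (comp (Cgh n a) lapU)) P P K (δ / 16) := by
  obtain ⟨K, hK⟩ := exists_biLoc_LC_qW hG hδ hδ1 C
  exact ⟨_, fun P w hw => biLoc_comp_right (hK P w hw) (decays_of_le (decays_CL hG hδ hδ1) (by linarith)) (by linarith) (by linarith)⟩

end SingleWeight

/-! ## §2 Two-weight kernels at `(P, P′)` WITH SEPARATION -/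

section TwoWeight

variable {n : ℕ} [NeZero n] {a : ℝ} {CG δ : ℝ}

/-- [our object] The diagonal pair table is the superposition of the pair stencils with the PRODUCT weight. -/
theorem d2W_eq_wsum_mul (w w' : Fin 4 → (Fin 4 → ℤ) → ℝ) :
    d2W w w' = fun x y a b => ∑ κ : Fin 4, wsum (fun u => w κ u * w' κ u) (gh₂ κ) x y a b := by
  funext x y a b
  simp only [d2W, wsum]
  exact Finset.sum_congr rfl fun κ _ => tsum_congr fun u => by ring

/-- [folklore] **THE DIAGONAL PAIR TABLE `d2W w w′` AT `(P,P)`, RATE `δ∕4`, WITH `e^{−(δ∕2)|P−P′|₁}` IN THE CONSTANT** (`abs_mul_weight_sep`). -/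
theorem exists_biLoc_d2W_sep (hδ : 0 < δ) (C C' : ℝ) :
    ∃ K : ℝ, ∀ (P P' : Site 4) (w w' : Fin 4 → (Fin 4 → ℤ) → ℝ), (∀ κ u, |w κ u| ≤ C * Real.exp (-δ * l1 (u - P))) →
      (∀ κ u, |w' κ u| ≤ C' * Real.exp (-δ * l1 (u - P'))) →
      BiLoc (d2W w w') P P (K * Real.exp (-(δ / 2) * l1 (P - P'))) (δ / 4) := by
  refine ⟨4 * (C * C') * (Real.exp (δ / 2) + Real.exp (δ / 2)) * Zl (3 + 1) (δ / 4), fun P P' w w' hw hw' => ?_⟩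
  have hC : 0 ≤ C := const_nonneg_of_weight (hw 0)
  have hC' : 0 ≤ C' := const_nonneg_of_weight (hw' 0)
  have hω : ∀ κ u, |w κ u * w' κ u| ≤ C * C' * Real.exp (-(δ / 2) * l1 (P - P')) * Real.exp (-(δ / 2) * l1 (u - P)) :=
    abs_mul_weight_sep hw hw' hδ.le
  have h := biLoc_dirsum_wsum (d := 3) hω (fun κ u => biLoc_gh₂ κ u (δ / 2)) (half_pos hδ)
    (mul_nonneg (mul_nonneg hC hC') (Real.exp_pos _).le)
  rw [show δ / 2 / 2 = δ / 4 by ring] at h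
  rw [d2W_eq_wsum_mul]
  refine biLoc_weaken h (le_of_eq ?_) le_rfl
  simp only [Finset.sum_const, Finset.card_univ, Fintype.card_fin]
  push_cast
  ring

/-- [folklore] **`gW w ∘ gW w′` AT `(P,P′)`**: rate `δ∕2`, separation `e^{−(δ∕4)|P−P′|₁}` (`biLoc_comp_biLoc`). -/
theorem exists_biLoc_gW_gW_sep (hδ : 0 < δ) (C C' : ℝ) :
    ∃ K : ℝ, ∀ (P P' : Site 4) (w w' : Fin 4 → (Fin 4 → ℤ) → ℝ), (∀ κ u, |w κ u| ≤ C * Real.exp (-δ * l1 (u - P))) →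
      (∀ κ u, |w' κ u| ≤ C' * Real.exp (-δ * l1 (u - P'))) →
      BiLoc (comp (gW w) (gW w')) P P' (K * Real.exp (-(δ / 4) * l1 (P - P'))) (δ / 2) := by
  refine ⟨(Fintype.card Unit : ℝ) * ((∑ _κ : Fin (3 + 1), C * Real.exp δ * Zl (3 + 1) (δ / 2))
      * (∑ _κ : Fin (3 + 1), C' * Real.exp δ * Zl (3 + 1) (δ / 2))) * Zl 4 (δ / 4), fun P P' w w' hw hw' => ?_⟩
  have h := biLoc_comp_biLoc_sep (biLoc_gW hw hδ) (biLoc_gW hw' hδ) (half_pos hδ)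
  rw [show δ / 2 / 2 = δ / 4 by ring] at h
  exact h

/-- [folklore] **`gW w ∘ Cgh ∘ gW w′` AT `(P,P′)`**: rate `δ∕4`, separation `e^{−(δ∕8)|P−P′|₁}`. -/
theorem exists_biLoc_gW_C_gW_sep (hG : Decays (Cgh n a) CG δ) (hδ : 0 < δ) (C C' : ℝ) :
    ∃ K : ℝ, ∀ (P P' : Site 4) (w w' : Fin 4 → (Fin 4 → ℤ) → ℝ), (∀ κ u, |w κ u| ≤ C * Real.exp (-δ * l1 (u - P))) →
      (∀ κ u, |w' κ u| ≤ C' * Real.exp (-δ * l1 (u - P'))) →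
      BiLoc (comp (comp (gW w) (Cgh n a)) (gW w')) P P' (K * Real.exp (-(δ / 8) * l1 (P - P'))) (δ / 4) := by
  obtain ⟨K1, h1⟩ := exists_biLoc_gW_C hG hδ C
  refine ⟨(Fintype.card Unit : ℝ) * (K1 * (∑ _κ : Fin (3 + 1), C' * Real.exp δ * Zl (3 + 1) (δ / 2))) * Zl 4 (δ / 8),
    fun P P' w w' hw hw' => ?_⟩
  have hg' : BiLoc (gW w') P' P' (∑ _κ : Fin (3 + 1), C' * Real.exp δ * Zl (3 + 1) (δ / 2)) (δ / 4) :=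
    biLoc_weaken (biLoc_gW hw' hδ) le_rfl (by linarith)
  have h := biLoc_comp_biLoc_sep (h1 P w hw) hg' (by linarith : 0 < δ / 4)
  rw [show δ / 4 / 2 = δ / 8 by ring] at h
  exact h

/-- [folklore] **`(lapU∘Cgh∘qW w)∘Cgh∘gW w′` AT `(P,P′)`**: rate `δ∕16`, separation `e^{−(δ∕32)|P−P′|₁}`. -/
theorem exists_biLoc_Y4_gW_sep (hG : Decays (Cgh n a) CG δ) (hδ : 0 < δ) (hδ1 : δ ≤ 1) (C C' : ℝ) :
    ∃ K : ℝ, ∀ (P P' : Site 4) (w w' : Fin 4 → (Fin 4 → ℤ) → ℝ), (∀ κ u, |w κ u| ≤ C * Real.exp (-δ * l1 (u - P))) →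
      (∀ κ u, |w' κ u| ≤ C' * Real.exp (-δ * l1 (u - P'))) →
      BiLoc (comp (comp (comp (comp lapU (Cgh n a)) (qW w)) (Cgh n a)) (gW w')) P P' (K * Real.exp (-(δ / 32) * l1 (P - P'))) (δ / 16) := by
  obtain ⟨K4, h4⟩ := exists_biLoc_LC_qW_C hG hδ hδ1 C
  refine ⟨(Fintype.card Unit : ℝ) * (K4 * (∑ _κ : Fin (3 + 1), C' * Real.exp δ * Zl (3 + 1) (δ / 2))) * Zl 4 (δ / 32),
    fun P P' w w' hw hw' => ?_⟩
  have hg' : BiLoc (gW w') P' P' (∑ _κ : Fin (3 + 1), C' * Real.exp δ * Zl (3 + 1) (δ / 2)) (δ / 16) :=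
    biLoc_weaken (biLoc_gW hw' hδ) le_rfl (by linarith)
  have h := biLoc_comp_biLoc_sep (h4 P w hw) hg' (by linarith : 0 < δ / 16)
  rw [show δ / 16 / 2 = δ / 32 by ring] at h
  exact h

/-- [folklore] **`((lapU∘Cgh∘qW w)∘Cgh∘qW w′)∘(Cgh∘lapU)` AT `(P,P′)`**: rate `δ∕32`, separation `e^{−(δ∕32)|P−P′|₁}`. -/
theorem exists_biLoc_Y4_qW_CL_sep (hG : Decays (Cgh n a) CG δ) (hδ : 0 < δ) (hδ1 : δ ≤ 1) (C C' : ℝ) :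
    ∃ K : ℝ, ∀ (P P' : Site 4) (w w' : Fin 4 → (Fin 4 → ℤ) → ℝ), (∀ κ u, |w κ u| ≤ C * Real.exp (-δ * l1 (u - P))) →
      (∀ κ u, |w' κ u| ≤ C' * Real.exp (-δ * l1 (u - P'))) →
      BiLoc (comp (comp (comp (comp (comp lapU (Cgh n a)) (qW w)) (Cgh n a)) (qW w')) (comp (Cgh n a) lapU)) P P'
        (K * Real.exp (-(δ / 32) * l1 (P - P'))) (δ / 32) := by
  obtain ⟨K4, h4⟩ := exists_biLoc_LC_qW_C hG hδ hδ1 C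
  obtain ⟨Kq, hq⟩ : ∃ Kq : ℝ, ∀ (P' : Site 4) (w' : Fin 4 → (Fin 4 → ℤ) → ℝ), (∀ κ u, |w' κ u| ≤ C' * Real.exp (-δ * l1 (u - P'))) →
      BiLoc (qW w') P' P' Kq (δ / 16) :=
    ⟨_, fun P' w' hw' => biLoc_weaken (biLoc_qW hw' hδ hδ1) le_rfl (by linarith)⟩
  refine ⟨(Fintype.card Unit : ℝ) * (((Fintype.card Unit : ℝ) * (K4 * Kq) * Zl 4 (δ / 32))
      * |(Fintype.card Unit : ℝ) * (CG * |16 * Real.exp 1|) * Zl 4 (δ - δ / 2)|) * Zl 4 (δ / 16 - δ / 32), fun P P' w w' hw hw' => ?_⟩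
  have h := biLoc_comp_biLoc_sep (h4 P w hw) (hq P' w' hw') (by linarith : 0 < δ / 16)
  rw [show δ / 16 / 2 = δ / 32 by ring] at h
  exact biLoc_comp_right_sep h (decays_of_le (decays_CL hG hδ hδ1) (by linarith)) (by linarith) (by linarith)

/-- [folklore] **`d2W w w′ ∘ lapU` AT `(P,P)`**: rate `δ∕8`, separation `e^{−(δ∕2)|P−P′|₁}` kept. -/
theorem exists_biLoc_d2W_L_sep (hδ : 0 < δ) (hδ1 : δ ≤ 1) (C C' : ℝ) :
    ∃ K : ℝ, ∀ (P P' : Site 4) (w w' : Fin 4 → (Fin 4 → ℤ) → ℝ), (∀ κ u, |w κ u| ≤ C * Real.exp (-δ * l1 (u - P))) →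
      (∀ κ u, |w' κ u| ≤ C' * Real.exp (-δ * l1 (u - P'))) →
      BiLoc (comp (d2W w w') lapU) P P (K * Real.exp (-(δ / 2) * l1 (P - P'))) (δ / 8) := by
  obtain ⟨K0, h0⟩ := exists_biLoc_d2W_sep hδ C C'
  exact ⟨(Fintype.card Unit : ℝ) * (K0 * |16 * Real.exp 1|) * Zl 4 (δ / 4 - δ / 8), fun P P' w w' hw hw' =>
    biLoc_comp_right_sep (h0 P P' w w' hw hw') (decays_lapU_of_le_one (by linarith)) (by linarith) (by linarith)⟩

/-- [folklore] **`lapU ∘ d2W w w′` AT `(P,P)`**: rate `δ∕8`, separation `e^{−(δ∕2)|P−P′|₁}` kept. -/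
theorem exists_biLoc_L_d2W_sep (hδ : 0 < δ) (hδ1 : δ ≤ 1) (C C' : ℝ) :
    ∃ K : ℝ, ∀ (P P' : Site 4) (w w' : Fin 4 → (Fin 4 → ℤ) → ℝ), (∀ κ u, |w κ u| ≤ C * Real.exp (-δ * l1 (u - P))) →
      (∀ κ u, |w' κ u| ≤ C' * Real.exp (-δ * l1 (u - P'))) →
      BiLoc (comp lapU (d2W w w')) P P (K * Real.exp (-(δ / 2) * l1 (P - P'))) (δ / 8) := by
  obtain ⟨K0, h0⟩ := exists_biLoc_d2W_sep hδ C C'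
  exact ⟨(Fintype.card Unit : ℝ) * (|16 * Real.exp 1| * K0) * Zl 4 (δ / 4 - δ / 8), fun P P' w w' hw hw' =>
    biLoc_comp_decays_sep (decays_lapU_of_le_one (by linarith)) (h0 P P' w w' hw hw') (by linarith) (by linarith)⟩

/-- [folklore] **THE `lapU∘Cgh ∘ T ∘ Cgh∘lapU` SANDWICH** of a kernel `T` bi-localised at `(p,q)` with separation factor `E`: rate `ρ∕4`, `E` kept
(`0 < ρ ≤ δ∕2`). -/
theorem biLoc_LC_T_CL (hG : Decays (Cgh n a) CG δ) (hδ : 0 < δ) (hδ1 : δ ≤ 1) {T : MKer 4 Unit} {p q : Site 4} {K₀ E ρ : ℝ}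
    (hT : BiLoc T p q (K₀ * E) ρ) (hρ : 0 < ρ) (hρδ : ρ ≤ δ / 2) :
    BiLoc (comp (comp (comp lapU (Cgh n a)) T) (comp (Cgh n a) lapU)) p q
      (((Fintype.card Unit : ℝ) * (((Fintype.card Unit : ℝ) * (|(Fintype.card Unit : ℝ) * (|16 * Real.exp 1| * CG) * Zl 4 (δ - δ / 2)| * K₀)
          * Zl 4 (ρ - ρ / 2)) * |(Fintype.card Unit : ℝ) * (CG * |16 * Real.exp 1|) * Zl 4 (δ - δ / 2)|) * Zl 4 (ρ / 2 - ρ / 4)) * E) (ρ / 4) := by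
  have h1 := biLoc_comp_decays_sep (decays_of_le (decays_LC hG hδ hδ1) hρδ) hT (by linarith : 0 ≤ ρ / 2) (by linarith)
  exact biLoc_comp_right_sep h1 (decays_of_le (decays_CL hG hδ hδ1) (by linarith : ρ / 2 ≤ δ / 2)) (by linarith) (by linarith)

end TwoWeight

/-! ## §3 The thirteen word shapes: `∃ K, ∀ P P′ w w′, … → BiLoc word p q (K·e^{−s|P−P′|₁}) ρ` -/

section Words

variable {n : ℕ} [NeZero n] {a : ℝ} {CG CR δ : ℝ}

/-- [folklore] **W1 `dSw (lapU∘Cgh∘d2W w w′)` AT `(P,P)`**: separation `e^{−(δ∕2)|P−P′|₁}`, rate `δ∕8`. -/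
theorem exists_biLoc_W1 (hG : Decays (Cgh n a) CG δ) (hδ : 0 < δ) (hδ1 : δ ≤ 1) (C C' : ℝ) :
    ∃ K : ℝ, ∀ (P P' : Site 4) (w w' : Fin 4 → (Fin 4 → ℤ) → ℝ), (∀ κ u, |w κ u| ≤ C * Real.exp (-δ * l1 (u - P))) →
      (∀ κ u, |w' κ u| ≤ C' * Real.exp (-δ * l1 (u - P'))) →
      BiLoc (dSw (comp (comp lapU (Cgh n a)) (d2W w w'))) P P (K * Real.exp (-(δ / 2) * l1 (P - P'))) (δ / 8) := by
  obtain ⟨K0, h0⟩ := exists_biLoc_d2W_sep hδ C C'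
  exact ⟨4 * ((Fintype.card Unit : ℝ) * (|(Fintype.card Unit : ℝ) * (|16 * Real.exp 1| * CG) * Zl 4 (δ - δ / 2)| * K0) * Zl 4 (δ / 4 - δ / 8))
      * Real.exp (2 * (δ / 8)), fun P P' w w' hw hw' =>
    biLoc_dSw₂ (by linarith) (biLoc_comp_decays_sep (decays_of_le (decays_LC hG hδ hδ1) (by linarith)) (h0 P P' w w' hw hw')
      (by linarith) (by linarith))⟩

/-- [folklore] **W2 `jetCw w′ (lapU∘Cgh∘gW w)` AT `(P,P′)`**: separation `e^{−(δ∕8)|P−P′|₁}`, rate `δ∕8` (swap `w ↔ w′` for W3). -/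
theorem exists_biLoc_W2 (hG : Decays (Cgh n a) CG δ) (hδ : 0 < δ) (hδ1 : δ ≤ 1) (C C' : ℝ) :
    ∃ K : ℝ, ∀ (P P' : Site 4) (w w' : Fin 4 → (Fin 4 → ℤ) → ℝ), (∀ κ u, |w κ u| ≤ C * Real.exp (-δ * l1 (u - P))) →
      (∀ κ u, |w' κ u| ≤ C' * Real.exp (-δ * l1 (u - P'))) →
      BiLoc (jetCw w' (comp (comp lapU (Cgh n a)) (gW w))) P P' (K * Real.exp (-(δ / 8) * l1 (P - P'))) (δ / 8) := by
  obtain ⟨K1, h1⟩ := exists_biLoc_LC_gW hG hδ hδ1 C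
  refine ⟨2 * C' * K1 * Real.exp (2 * (δ / 4)), fun P P' w w' hw hw' => ?_⟩
  have h := biLoc_jetCw_of_biLoc hw' (h1 P w hw) (by linarith : 0 ≤ δ / 4) (by linarith)
  rw [show δ / 4 / 2 = δ / 8 by ring] at h
  exact h

omit [NeZero n] in
/-- [folklore] **W4 `jetCw (w·w′) Rgt` AT `(P,P)`**: the product weight carries `e^{−(δ∕2)|P−P′|₁}`; rate `δ∕4`. -/
theorem exists_biLoc_W4 (hR : Decays (Rgt n a) CR δ) (hδ : 0 < δ) (C C' : ℝ) :
    ∃ K : ℝ, ∀ (P P' : Site 4) (w w' : Fin 4 → (Fin 4 → ℤ) → ℝ), (∀ κ u, |w κ u| ≤ C * Real.exp (-δ * l1 (u - P))) →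
      (∀ κ u, |w' κ u| ≤ C' * Real.exp (-δ * l1 (u - P'))) →
      BiLoc (jetCw (fun κ u => w κ u * w' κ u) (Rgt n a)) P P (K * Real.exp (-(δ / 2) * l1 (P - P'))) (δ / 4) := by
  refine ⟨2 * (C * C') * |CR| * Real.exp (2 * (δ / 2)), fun P P' w w' hw hw' => ?_⟩
  have hω : ∀ β z, |w β z * w' β z| ≤ C * C' * Real.exp (-(δ / 2) * l1 (P - P')) * Real.exp (-(δ / 2) * l1 (z - P)) :=
    abs_mul_weight_sep hw hw' hδ.le
  have h := biLoc_jetCw_of_decays hω (decays_of_le hR (by linarith : δ / 2 ≤ δ)) (by linarith : 0 ≤ δ / 2)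
  rw [show δ / 2 / 2 = δ / 4 by ring] at h
  exact biLoc_weaken h (le_of_eq (by ring)) le_rfl

/-- [folklore] **W5 `dSw (gW w∘Cgh∘gW w′)` AT `(P,P′)`**: separation `e^{−(δ∕8)|P−P′|₁}`, rate `δ∕4`. -/
theorem exists_biLoc_W5 (hG : Decays (Cgh n a) CG δ) (hδ : 0 < δ) (C C' : ℝ) :
    ∃ K : ℝ, ∀ (P P' : Site 4) (w w' : Fin 4 → (Fin 4 → ℤ) → ℝ), (∀ κ u, |w κ u| ≤ C * Real.exp (-δ * l1 (u - P))) →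
      (∀ κ u, |w' κ u| ≤ C' * Real.exp (-δ * l1 (u - P'))) →
      BiLoc (dSw (comp (comp (gW w) (Cgh n a)) (gW w'))) P P' (K * Real.exp (-(δ / 8) * l1 (P - P'))) (δ / 4) := by
  obtain ⟨K2, h2⟩ := exists_biLoc_gW_C_gW_sep hG hδ C C'
  exact ⟨4 * K2 * Real.exp (2 * (δ / 4)), fun P P' w w' hw hw' => biLoc_dSw₂ (by linarith) (h2 P P' w w' hw hw')⟩

/-- [folklore] **W6 `jetCw w′ (gW w∘Cgh∘lapU)` AT `(P,P′)`**: separation `e^{−(δ∕8)|P−P′|₁}`, rate `δ∕8`. -/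
theorem exists_biLoc_W6 (hG : Decays (Cgh n a) CG δ) (hδ : 0 < δ) (hδ1 : δ ≤ 1) (C C' : ℝ) :
    ∃ K : ℝ, ∀ (P P' : Site 4) (w w' : Fin 4 → (Fin 4 → ℤ) → ℝ), (∀ κ u, |w κ u| ≤ C * Real.exp (-δ * l1 (u - P))) →
      (∀ κ u, |w' κ u| ≤ C' * Real.exp (-δ * l1 (u - P'))) →
      BiLoc (jetCw w' (comp (gW w) (comp (Cgh n a) lapU))) P P' (K * Real.exp (-(δ / 8) * l1 (P - P'))) (δ / 8) := by
  obtain ⟨K1, h1⟩ := exists_biLoc_gW_CL hG hδ hδ1 C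
  refine ⟨2 * C' * K1 * Real.exp (2 * (δ / 4)), fun P P' w w' hw hw' => ?_⟩
  have h := biLoc_jetCw_of_biLoc hw' (h1 P w hw) (by linarith : 0 ≤ δ / 4) (by linarith)
  rw [show δ / 4 / 2 = δ / 8 by ring] at h
  exact h

/-- [folklore] **W7 `jetRw w (lapU∘Cgh∘gW w′)` AT `(P,P′)`**: separation `e^{−(δ∕8)|P′−P|₁}`, rate `δ∕8`. -/
theorem exists_biLoc_W7 (hG : Decays (Cgh n a) CG δ) (hδ : 0 < δ) (hδ1 : δ ≤ 1) (C C' : ℝ) :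
    ∃ K : ℝ, ∀ (P P' : Site 4) (w w' : Fin 4 → (Fin 4 → ℤ) → ℝ), (∀ κ u, |w κ u| ≤ C * Real.exp (-δ * l1 (u - P))) →
      (∀ κ u, |w' κ u| ≤ C' * Real.exp (-δ * l1 (u - P'))) →
      BiLoc (jetRw w (comp (comp lapU (Cgh n a)) (gW w'))) P P' (K * Real.exp (-(δ / 8) * l1 (P' - P))) (δ / 8) := by
  obtain ⟨K1, h1⟩ := exists_biLoc_LC_gW hG hδ hδ1 C'
  refine ⟨2 * C * K1 * Real.exp (2 * (δ / 4)), fun P P' w w' hw hw' => ?_⟩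
  have h := biLoc_jetRw_of_biLoc hw (h1 P' w' hw') (by linarith : 0 ≤ δ / 4) (by linarith)
  rw [show δ / 4 / 2 = δ / 8 by ring] at h
  exact h

omit [NeZero n] in
/-- [folklore] **W8 `jetRCw w w′ Rgt` AT `(P,P′)`**: separation `e^{−(δ∕2)|P−P′|₁}`, rate `δ∕2`. -/
theorem exists_biLoc_W8 (hR : Decays (Rgt n a) CR δ) (hδ : 0 < δ) (C C' : ℝ) :
    ∃ K : ℝ, ∀ (P P' : Site 4) (w w' : Fin 4 → (Fin 4 → ℤ) → ℝ), (∀ κ u, |w κ u| ≤ C * Real.exp (-δ * l1 (u - P))) →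
      (∀ κ u, |w' κ u| ≤ C' * Real.exp (-δ * l1 (u - P'))) →
      BiLoc (jetRCw w w' (Rgt n a)) P P' (K * Real.exp (-(δ / 2) * l1 (P - P'))) (δ / 2) :=
  ⟨C * C' * CR * Real.exp (2 * δ), fun _ _ _ _ hw hw' => biLoc_jetRCw_sep hw hw' hR hδ.le⟩

/-- [folklore] **W9 `dSw ((lapU∘Cgh∘qW w∘Cgh)∘gW w′)` AT `(P,P′)`**: separation `e^{−(δ∕32)|P−P′|₁}`, rate `δ∕16`. -/
theorem exists_biLoc_W9 (hG : Decays (Cgh n a) CG δ) (hδ : 0 < δ) (hδ1 : δ ≤ 1) (C C' : ℝ) :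
    ∃ K : ℝ, ∀ (P P' : Site 4) (w w' : Fin 4 → (Fin 4 → ℤ) → ℝ), (∀ κ u, |w κ u| ≤ C * Real.exp (-δ * l1 (u - P))) →
      (∀ κ u, |w' κ u| ≤ C' * Real.exp (-δ * l1 (u - P'))) →
      BiLoc (dSw (comp (comp (comp (comp lapU (Cgh n a)) (qW w)) (Cgh n a)) (gW w'))) P P' (K * Real.exp (-(δ / 32) * l1 (P - P'))) (δ / 16) := by
  obtain ⟨K3, h3⟩ := exists_biLoc_Y4_gW_sep hG hδ hδ1 C C'
  exact ⟨4 * K3 * Real.exp (2 * (δ / 16)), fun P P' w w' hw hw' => biLoc_dSw₂ (by linarith) (h3 P P' w w' hw hw')⟩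

/-- [folklore] **W10 `jetCw w′ (lapU∘Cgh∘qW w∘Cgh∘lapU)` AT `(P,P′)`**: separation `e^{−(δ∕32)|P−P′|₁}`, rate `δ∕32`. -/
theorem exists_biLoc_W10 (hG : Decays (Cgh n a) CG δ) (hδ : 0 < δ) (hδ1 : δ ≤ 1) (C C' : ℝ) :
    ∃ K : ℝ, ∀ (P P' : Site 4) (w w' : Fin 4 → (Fin 4 → ℤ) → ℝ), (∀ κ u, |w κ u| ≤ C * Real.exp (-δ * l1 (u - P))) →
      (∀ κ u, |w' κ u| ≤ C' * Real.exp (-δ * l1 (u - P'))) →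
      BiLoc (jetCw w' (comp (comp (comp lapU (Cgh n a)) (qW w)) (comp (Cgh n a) lapU))) P P'
        (K * Real.exp (-(δ / 32) * l1 (P - P'))) (δ / 32) := by
  obtain ⟨K1, h1⟩ := exists_biLoc_LC_qW_CL hG hδ hδ1 C
  refine ⟨2 * C' * K1 * Real.exp (2 * (δ / 16)), fun P P' w w' hw hw' => ?_⟩
  have h := biLoc_jetCw_of_biLoc hw' (h1 P w hw) (by linarith : 0 ≤ δ / 16) (by linarith)
  rw [show δ / 16 / 2 = δ / 32 by ring] at h
  exact h

/-- [folklore] **W11a `dSw (LC∘(d2W w w′∘lapU)∘CL)` AT `(P,P)`**: separation `e^{−(δ∕2)|P−P′|₁}`, rate `δ∕32`. -/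
theorem exists_biLoc_W11a (hG : Decays (Cgh n a) CG δ) (hδ : 0 < δ) (hδ1 : δ ≤ 1) (C C' : ℝ) :
    ∃ K : ℝ, ∀ (P P' : Site 4) (w w' : Fin 4 → (Fin 4 → ℤ) → ℝ), (∀ κ u, |w κ u| ≤ C * Real.exp (-δ * l1 (u - P))) →
      (∀ κ u, |w' κ u| ≤ C' * Real.exp (-δ * l1 (u - P'))) →
      BiLoc (dSw (comp (comp (comp lapU (Cgh n a)) (comp (d2W w w') lapU)) (comp (Cgh n a) lapU))) P P
        (K * Real.exp (-(δ / 2) * l1 (P - P'))) (δ / 32) := by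
  obtain ⟨Ka, ha⟩ := exists_biLoc_d2W_L_sep hδ hδ1 C C'
  exact ⟨_, fun P P' w w' hw hw' => by
    have h := biLoc_dSw₂ (by linarith : 0 ≤ δ / 8 / 4) (biLoc_LC_T_CL hG hδ hδ1 (ha P P' w w' hw hw') (by linarith) (by linarith))
    rw [show δ / 8 / 4 = δ / 32 by ring] at h
    exact h⟩

/-- [folklore] **W11b `dSw (LC∘(gW w∘gW w′)∘CL)` AT `(P,P′)`**: separation `e^{−(δ∕4)|P−P′|₁}`, rate `δ∕8` (swap `w ↔ w′` for W11c). -/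
theorem exists_biLoc_W11b (hG : Decays (Cgh n a) CG δ) (hδ : 0 < δ) (hδ1 : δ ≤ 1) (C C' : ℝ) :
    ∃ K : ℝ, ∀ (P P' : Site 4) (w w' : Fin 4 → (Fin 4 → ℤ) → ℝ), (∀ κ u, |w κ u| ≤ C * Real.exp (-δ * l1 (u - P))) →
      (∀ κ u, |w' κ u| ≤ C' * Real.exp (-δ * l1 (u - P'))) →
      BiLoc (dSw (comp (comp (comp lapU (Cgh n a)) (comp (gW w) (gW w'))) (comp (Cgh n a) lapU))) P P'
        (K * Real.exp (-(δ / 4) * l1 (P - P'))) (δ / 8) := by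
  obtain ⟨Kb, hb⟩ := exists_biLoc_gW_gW_sep hδ C C'
  exact ⟨_, fun P P' w w' hw hw' => by
    have h := biLoc_dSw₂ (by linarith : 0 ≤ δ / 2 / 4) (biLoc_LC_T_CL hG hδ hδ1 (hb P P' w w' hw hw') (by linarith) (by linarith))
    rw [show δ / 2 / 4 = δ / 8 by ring] at h
    exact h⟩

/-- [folklore] **W11d `dSw (LC∘(lapU∘d2W w w′)∘CL)` AT `(P,P)`**: separation `e^{−(δ∕2)|P−P′|₁}`, rate `δ∕32`. -/
theorem exists_biLoc_W11d (hG : Decays (Cgh n a) CG δ) (hδ : 0 < δ) (hδ1 : δ ≤ 1) (C C' : ℝ) :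
    ∃ K : ℝ, ∀ (P P' : Site 4) (w w' : Fin 4 → (Fin 4 → ℤ) → ℝ), (∀ κ u, |w κ u| ≤ C * Real.exp (-δ * l1 (u - P))) →
      (∀ κ u, |w' κ u| ≤ C' * Real.exp (-δ * l1 (u - P'))) →
      BiLoc (dSw (comp (comp (comp lapU (Cgh n a)) (comp lapU (d2W w w'))) (comp (Cgh n a) lapU))) P P
        (K * Real.exp (-(δ / 2) * l1 (P - P'))) (δ / 32) := by
  obtain ⟨Kd, hd⟩ := exists_biLoc_L_d2W_sep hδ hδ1 C C'
  exact ⟨_, fun P P' w w' hw hw' => by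
    have h := biLoc_dSw₂ (by linarith : 0 ≤ δ / 8 / 4) (biLoc_LC_T_CL hG hδ hδ1 (hd P P' w w' hw hw') (by linarith) (by linarith))
    rw [show δ / 8 / 4 = δ / 32 by ring] at h
    exact h⟩

/-- [folklore] **W12 `dSw (((lapU∘Cgh∘qW w∘Cgh)∘qW w′)∘(Cgh∘lapU))` AT `(P,P′)`**: separation `e^{−(δ∕32)|P−P′|₁}`, rate `δ∕32` (swap for W12′). -/
theorem exists_biLoc_W12 (hG : Decays (Cgh n a) CG δ) (hδ : 0 < δ) (hδ1 : δ ≤ 1) (C C' : ℝ) :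
    ∃ K : ℝ, ∀ (P P' : Site 4) (w w' : Fin 4 → (Fin 4 → ℤ) → ℝ), (∀ κ u, |w κ u| ≤ C * Real.exp (-δ * l1 (u - P))) →
      (∀ κ u, |w' κ u| ≤ C' * Real.exp (-δ * l1 (u - P'))) →
      BiLoc (dSw (comp (comp (comp (comp (comp lapU (Cgh n a)) (qW w)) (Cgh n a)) (qW w')) (comp (Cgh n a) lapU))) P P'
        (K * Real.exp (-(δ / 32) * l1 (P - P'))) (δ / 32) := by
  obtain ⟨K4, h4⟩ := exists_biLoc_Y4_qW_CL_sep hG hδ hδ1 C C'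
  exact ⟨4 * K4 * Real.exp (2 * (δ / 32)), fun P P' w w' hw hw' => biLoc_dSw₂ (by linarith) (h4 P P' w w' hw hw')⟩

end Words

end Summit.QuantumFields.BalabanUV.Beta.D1BFx.PackedCoframeSepKernels

end
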